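/-
Copyright (c) 2026 the pub-hodgecm-mathlib formalisation cell (harness21).  Prover seat hodgecm-mathlib-K2Liu-p11 (g2), Track B «K2-LIT»,
#184♮ = hLiu418 = `stmt-HodgeConjecture-24832`; S5-W1-arch row (RULING «M-157o»; K2Liu-p01 (g7) 10:11:08Z «FILE 2 is needed for a = +1
AND a = −1, all `K_σ`-types»; LEAD F0P6-plan (g13) 10:02:45Z «a = −1 higher types if K2Liu-p01 names the sign»).  THEOREMS ONLY
(no `def`, no `instance`, no notation, no named-fact hypothesis, no `sorry`).
-/
import Summits.HodgeConjecture.HodgeConjecture.Theorems.K2LiuRankOneArchWhittakerEvenHolomorphy   -- ★ (this lineage): a = +1, all types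
import Mathlib.MeasureTheory.Integral.Bochner.ContinuousLinearMap
import Mathlib.Analysis.Calculus.Deriv.Star
import HarnessLib

/-!
# Crux `HLiu418`, S5-W1-arch, the MIRROR LINE `a = −1` FOR EVERY `K`-TYPE by ONE conjugation symmetry

Cell `hodgecm-mathlib`, crux item hLiu418 = `stmt-HodgeConjecture-24832` (helper lane `--supports`, count-neutral).

The rank-one archimedean Whittaker integrals `W^{(k)}_h(s) = ∫_ℝ f⁰_{s,k}(J·n(b)) e^{−2πihb} db` of the scalar types `k` satisfy the
exact MIRROR SYMMETRY `W^{(−k)}_h(s) = conj W^{(k)}_{−h}(conj s)` (§2 `whittaker_neg_weight_eq_conj`), because on the big cell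
`f⁰_{s,−k}(J·n(b)) = conj f⁰_{conj s, k}(J·n(b))` (§1 `archScalarSection_neg_weight_eq_conj`: `(b+i)^{k}|b+i|^{−k−2s−1}` vs
`(b−i)^{−k}|b+i|^{k−2s−1}`, equal since `(b−i)(b+i) = |b+i|²`).  Hence EVERY statement of the `a = +1` organ (★ `K2LiuRankOneArchWhittakerCentre`,
★ `K2LiuRankOneArchWhittakerEven`, ★ `K2LiuRankOneArchWhittakerEvenHolomorphy`: types `k = 2j+1`, wrong sign `h < 0`) transports to the
mirror line (types `k = −(2j+1)`, wrong sign `h > 0`) with the conjugated closed form `s ↦ conj CF_j(−h)(conj s)`: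
* §3 `oddWhittaker_neg_closedForm` (agreement on `re s > ½`), `differentiableOn_oddClosedForm_mirror` (holomorphic on `{−½ < re s}`,
  Mathlib `DifferentiableAt.conj_conj`), **`oddWhittaker_neg_centre_eq_zero_of_pos`** (the continued central value VANISHES for `h > 0`,
  every `j`), and the even negative types at `s = ½`: `integral_archScalarSection_neg_even_half_eq_zero` (`k = −2j`, `j ≥ 1`, `h > 0`).
So the S5-F2 assembly's `harch` letter is served for BOTH arch signs and ALL scalar `K_σ`-types (K2Liu-p01 (g7) 10:11:08Z (i)).
References: [Bump1997, §1.6] (derived; the `SL₂(ℝ)` prototype).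
HONEST LABEL: HC_CM is proved only modulo the 7 printed citations (2 remaining named inputs: hLiu418 = stmt-HodgeConjecture-24832,
h413 = stmt-HodgeConjecture-24833) until rung 0 closes; count-neutral helper, closes no socket.
-/

set_option autoImplicit false
set_option linter.dupNamespace false

noncomputable section

open Complex MeasureTheory Set Filter
open scoped ComplexConjugate ComplexOrder Topology

namespace Summit.HodgeConjecture.HodgeConjecture.Cruxes.HLiu418.K2LiuRankOneArchWhittakerMirrorTypes

open Summit.HodgeConjecture.HodgeConjecture.Cruxes.HLiu418.K2LiuArchInducedTubeDefs
open Summit.HodgeConjecture.HodgeConjecture.Cruxes.HLiu418.K2LiuRankOneArchWhittakerCentre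
open Summit.HodgeConjecture.HodgeConjecture.Cruxes.HLiu418.K2LiuRankOneArchWhittakerEven
open Summit.HodgeConjecture.HodgeConjecture.Cruxes.HLiu418.K2LiuRankOneArchWhittakerEvenHolomorphy

/-! ## §1  The conjugation symmetry of the scalar-type vectors on the big cell -/

/-- `conj (b + i) = b − i`. [folklore] -/
theorem conj_ofReal_add_I (β : ℝ) : conj ((β : ℂ) + I) = (β : ℂ) - I := by
  rw [map_add, Complex.conj_ofReal, Complex.conj_I, sub_eq_add_neg]

/-- `(b − i)(b + i) = |b + i|²` in `ℂ`. [folklore] -/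
theorem sub_I_mul_add_I (β : ℝ) : ((β : ℂ) - I) * ((β : ℂ) + I) = (((‖(β : ℂ) + I‖ : ℝ) : ℂ)) ^ 2 := by
  rw [← conj_ofReal_add_I, ← Complex.normSq_eq_conj_mul_self, Complex.normSq_eq_norm_sq, Complex.ofReal_pow]

/-- **MIRROR SYMMETRY OF THE SCALAR-TYPE VECTORS** (`l = 1`, big cell): `f⁰_{s,−k}(J·n(b)) = conj f⁰_{conj s, k}(J·n(b))`.
[Bump1997, §1.6] -/
theorem archScalarSection_neg_weight_eq_conj (k : ℤ) (s : ℂ) (β : ℝ) :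
    archScalarSection (-k) s (Matrix.J (Fin 1) ℂ * Matrix.fromBlocks 1 ((β : ℂ) • (1 : Matrix (Fin 1) (Fin 1) ℂ)) 0 1) =
      conj (archScalarSection k (conj s) (Matrix.J (Fin 1) ℂ * Matrix.fromBlocks 1 ((β : ℂ) • (1 : Matrix (Fin 1) (Fin 1) ℂ)) 0 1)) := by
  have hpos : 0 < ‖(β : ℂ) + I‖ := norm_ofReal_add_I_pos β
  have hx0 : (((‖(β : ℂ) + I‖ : ℝ) : ℂ)) ≠ 0 := Complex.ofReal_ne_zero.mpr hpos.ne'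
  have hz : ((β : ℂ) + I) ≠ 0 := ofReal_add_I_ne_zero β
  have hzc : ((β : ℂ) - I) ≠ 0 := by
    rw [← conj_ofReal_add_I]
    exact (map_ne_zero _).mpr hz
  -- `conj (x ^ w) = x ^ conj w` for the positive real base `x = |b+i|` (cf. ★ `Literature…conj_ofReal_cpow_of_nonneg`)
  have hconj : ∀ w : ℂ, conj ((((‖(β : ℂ) + I‖ : ℝ) : ℂ)) ^ w) = (((‖(β : ℂ) + I‖ : ℝ) : ℂ)) ^ conj w := by
    intro w
    have harg : (((‖(β : ℂ) + I‖ : ℝ) : ℂ)).arg ≠ Real.pi := by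
      rw [Complex.arg_ofReal_of_nonneg hpos.le]
      exact Real.pi_pos.ne
    have h := Complex.conj_cpow (((‖(β : ℂ) + I‖ : ℝ) : ℂ)) (conj w) harg
    rw [Complex.conj_conj, Complex.conj_ofReal] at h
    exact h.symm
  rw [archScalarSection_J_transl_fin_one, archScalarSection_J_transl_fin_one, map_mul, map_zpow₀, conj_ofReal_add_I,
    hconj, map_sub, map_sub, map_mul, Complex.conj_conj, map_intCast, map_one, Int.cast_neg, neg_neg]
  have h2 : conj (2 : ℂ) = 2 := map_ofNat _ 2
  rw [h2]
  -- `(b+i)^k · x^{−k−2s−1} = (b−i)^{−k} · x^{k−2s−1}`, `x = |b+i|`, via `(b−i)(b+i) = x²`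
  have hsplit : (((‖(β : ℂ) + I‖ : ℝ) : ℂ)) ^ ((k : ℂ) - 2 * s - 1) =
      (((‖(β : ℂ) + I‖ : ℝ) : ℂ)) ^ (-(k : ℂ) - 2 * s - 1) * (((‖(β : ℂ) + I‖ : ℝ) : ℂ)) ^ (2 * k : ℤ) := by
    rw [← Complex.cpow_intCast, ← Complex.cpow_add _ _ hx0]
    congr 1
    push_cast
    ring
  have hzk : ((β : ℂ) + I) ^ k ≠ 0 := zpow_ne_zero k hz
  have hzck : ((β : ℂ) - I) ^ k ≠ 0 := zpow_ne_zero k hzc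
  have hinv : ((β : ℂ) - I) ^ (-k) = ((β : ℂ) + I) ^ k * ((((‖(β : ℂ) + I‖ : ℝ) : ℂ)) ^ (2 * k : ℤ))⁻¹ := by
    rw [zpow_mul, zpow_two, ← pow_two, ← sub_I_mul_add_I, mul_zpow, zpow_neg]
    field_simp
  rw [hsplit, hinv]
  have hne : ((((‖(β : ℂ) + I‖ : ℝ) : ℂ)) ^ (2 * k : ℤ)) ≠ 0 := zpow_ne_zero _ hx0
  field_simp

/-! ## §2  The mirror symmetry of the Whittaker integrals -/

/-- `conj e^{−2πi(−h)b} = e^{−2πihb}`. [folklore] -/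
theorem conj_phase_neg (h b : ℝ) :
    conj (Complex.exp (-(2 * Real.pi * I * ((-h : ℝ) : ℂ) * b))) = Complex.exp (-(2 * Real.pi * I * h * b)) := by
  rw [← Complex.exp_conj]
  congr 1
  simp only [map_neg, map_mul, Complex.conj_ofReal, Complex.conj_I, map_ofNat]
  push_cast
  ring

/-- **MIRROR SYMMETRY OF THE WHITTAKER INTEGRALS**: `W^{(−k)}_h(s) = conj W^{(k)}_{−h}(conj s)` (as Bochner integrals, all `s`).
[Bump1997, §1.6] -/
theorem whittaker_neg_weight_eq_conj (k : ℤ) (s : ℂ) (h : ℝ) :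
    ∫ b : ℝ, archScalarSection (-k) s (Matrix.J (Fin 1) ℂ * Matrix.fromBlocks 1 ((b : ℂ) • (1 : Matrix (Fin 1) (Fin 1) ℂ)) 0 1) *
        Complex.exp (-(2 * Real.pi * I * h * b)) =
      conj (∫ b : ℝ, archScalarSection k (conj s) (Matrix.J (Fin 1) ℂ * Matrix.fromBlocks 1 ((b : ℂ) • (1 : Matrix (Fin 1) (Fin 1) ℂ)) 0 1) *
        Complex.exp (-(2 * Real.pi * I * ((-h : ℝ) : ℂ) * b))) := by
  rw [← integral_conj]
  refine integral_congr_ae (Eventually.of_forall fun b => ?_)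
  simp only [map_mul]
  rw [archScalarSection_neg_weight_eq_conj, conj_phase_neg]

/-! ## §3  The mirror line `a = −1`: every odd type `k = −(2j+1)`, and the even types at `s = ½` -/

/-- **THE MIRROR CLOSED FORM on `re s > ½`**: for `k = −(2j+1)`,
`W^{(−(2j+1))}_h(s) = conj CF_j(−h)(conj s)` with `CF_j` the telescoped closed form of ★ `oddWhittaker_closedForm`. [Bump1997, §1.6] -/
theorem oddWhittaker_neg_closedForm (j : ℕ) {s : ℂ} (hs : 1 / 2 < s.re) (h : ℝ) :
    ∫ b : ℝ, archScalarSection (-(2 * (j : ℤ) + 1)) s (Matrix.J (Fin 1) ℂ * Matrix.fromBlocks 1 ((b : ℂ) • (1 : Matrix (Fin 1) (Fin 1) ℂ)) 0 1) *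
        Complex.exp (-(2 * Real.pi * I * h * b)) =
      conj ((Complex.Gamma (conj s + 1))⁻¹ * ((Real.sqrt Real.pi : ℝ) : ℂ) *
        (-(Real.pi * Complex.I * ((-h : ℝ) : ℂ)) *
            mellin (fun t : ℝ => Complex.exp (-(t : ℂ) - ((Real.pi ^ 2 * (-h) ^ 2 : ℝ) : ℂ) / (t : ℂ))) (conj s - 1 / 2) -
          I * mellin (fun t : ℝ => Complex.exp (-(t : ℂ) - ((Real.pi ^ 2 * (-h) ^ 2 : ℝ) : ℂ) / (t : ℂ))) (conj s + 1 / 2)) -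
        2 * I * ∑ m ∈ Finset.range j, ∫ b : ℝ, ((b : ℂ) - I) ^ (2 * (m + 1)) *
          (((1 + b ^ 2 : ℝ)) : ℂ) ^ (-conj s - ((m + 1 : ℕ) : ℂ) - 1) * Complex.exp (-(2 * Real.pi * I * ((-h : ℝ) : ℂ) * b))) := by
  have hs' : 1 / 2 < (conj s).re := by rwa [Complex.conj_re]
  rw [whittaker_neg_weight_eq_conj, oddWhittaker_closedForm j hs' (-h)]

/-- **THE MIRROR CLOSED FORM IS HOLOMORPHIC ON `{−½ < re s}`** (`h ≠ 0`): `s ↦ conj CF_j(−h)(conj s)` (★ `differentiableOn_oddClosedForm`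
at `−h`, Mathlib `DifferentiableAt.conj_conj`). [Bump1997, §1.6] -/
theorem differentiableOn_oddClosedForm_mirror (j : ℕ) {h : ℝ} (hh : h ≠ 0) :
    DifferentiableOn ℂ (fun s : ℂ => conj ((Complex.Gamma (conj s + 1))⁻¹ * ((Real.sqrt Real.pi : ℝ) : ℂ) *
        (-(Real.pi * Complex.I * ((-h : ℝ) : ℂ)) *
            mellin (fun t : ℝ => Complex.exp (-(t : ℂ) - ((Real.pi ^ 2 * (-h) ^ 2 : ℝ) : ℂ) / (t : ℂ))) (conj s - 1 / 2) -
          I * mellin (fun t : ℝ => Complex.exp (-(t : ℂ) - ((Real.pi ^ 2 * (-h) ^ 2 : ℝ) : ℂ) / (t : ℂ))) (conj s + 1 / 2)) -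
        2 * I * ∑ m ∈ Finset.range j, ∫ b : ℝ, ((b : ℂ) - I) ^ (2 * (m + 1)) *
          (((1 + b ^ 2 : ℝ)) : ℂ) ^ (-conj s - ((m + 1 : ℕ) : ℂ) - 1) * Complex.exp (-(2 * Real.pi * I * ((-h : ℝ) : ℂ) * b))))
      {s : ℂ | -(1 / 2) < s.re} := by
  have hFd := differentiableOn_oddClosedForm j (neg_ne_zero.mpr hh)
  have hO : IsOpen {s : ℂ | -(1 / 2) < s.re} := isOpen_lt continuous_const Complex.continuous_re
  intro s hs
  have hs' : conj s ∈ {s : ℂ | -(1 / 2) < s.re} := by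
    simp only [mem_setOf_eq, Complex.conj_re]
    exact hs
  have hat := hFd.differentiableAt (hO.mem_nhds hs')
  have hcc := hat.conj_conj
  rw [Complex.conj_conj] at hcc
  exact hcc.differentiableWithinAt

/-- **THE MIRROR LINE, ALL ODD TYPES, WRONG SIGN: THE CONTINUED CENTRAL WHITTAKER VALUE VANISHES** (`a = −1`, `k = −(2j+1)`, `h > 0`):
the mirror closed form (§3, holomorphic on `{−½ < re s}`, equal to `W^{(−(2j+1))}_h(s)` on `re s > ½`) is `0` at `s = 0`
(★ `oddWhittaker_centre_eq_zero_of_neg j` at `−h < 0`, conjugated). [Bump1997, §1.6] -/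
theorem oddWhittaker_neg_centre_eq_zero_of_pos (j : ℕ) {h : ℝ} (hh : 0 < h) :
    conj ((Complex.Gamma (conj (0 : ℂ) + 1))⁻¹ * ((Real.sqrt Real.pi : ℝ) : ℂ) *
        (-(Real.pi * Complex.I * ((-h : ℝ) : ℂ)) *
            mellin (fun t : ℝ => Complex.exp (-(t : ℂ) - ((Real.pi ^ 2 * (-h) ^ 2 : ℝ) : ℂ) / (t : ℂ))) (conj (0 : ℂ) - 1 / 2) -
          I * mellin (fun t : ℝ => Complex.exp (-(t : ℂ) - ((Real.pi ^ 2 * (-h) ^ 2 : ℝ) : ℂ) / (t : ℂ))) (conj (0 : ℂ) + 1 / 2)) -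
        2 * I * ∑ m ∈ Finset.range j, ∫ b : ℝ, ((b : ℂ) - I) ^ (2 * (m + 1)) *
          (((1 + b ^ 2 : ℝ)) : ℂ) ^ (-conj (0 : ℂ) - ((m + 1 : ℕ) : ℂ) - 1) * Complex.exp (-(2 * Real.pi * I * ((-h : ℝ) : ℂ) * b))) = 0 := by
  rw [map_zero, oddWhittaker_centre_eq_zero_of_neg j (neg_neg_iff_pos.mpr hh), map_zero]

/-- **THE MIRROR LINE, EVEN TYPES AT `s = ½`, WRONG SIGN**: for `j ≥ 1` and `h > 0`, `∫_ℝ f⁰_{½,−2j}(J·n(b)) e^{−2πihb} db = 0`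
(★ `integral_archScalarSection_even_half_eq_zero` at `−h < 0`, conjugated). [Bump1997, §1.6] -/
theorem integral_archScalarSection_neg_even_half_eq_zero {j : ℕ} (hj : 1 ≤ j) {h : ℝ} (hh : 0 < h) :
    ∫ b : ℝ, archScalarSection (-(2 * (j : ℤ))) (1 / 2) (Matrix.J (Fin 1) ℂ * Matrix.fromBlocks 1 ((b : ℂ) • (1 : Matrix (Fin 1) (Fin 1) ℂ)) 0 1) *
        Complex.exp (-(2 * Real.pi * I * h * b)) = 0 := by
  have hhalf : conj (1 / 2 : ℂ) = 1 / 2 := by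
    rw [map_div₀, map_one, map_ofNat]
  rw [whittaker_neg_weight_eq_conj, hhalf, integral_archScalarSection_even_half_eq_zero hj (neg_neg_iff_pos.mpr hh), map_zero]

/-- **THE MIRROR GAUSSIAN LINE TYPE `k = −1` AT THE CENTRE, BY SYMMETRY** (consistency with ★ `K2LiuRankOneArchWhittakerCentreMirror`):
`W^{(−1)}_h(s) = conj W^{(1)}_{−h}(conj s)` and the `a = +1` closed form give, for `h > 0`, the vanishing of the continued central value
in the conjugated `E⁺`-form. [Bump1997, §1.6] -/
theorem lineWhittaker_neg_centre_eq_zero_of_pos {h : ℝ} (hh : 0 < h) :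
    conj ((Complex.Gamma (conj (0 : ℂ) + 1))⁻¹ * ((Real.sqrt Real.pi : ℝ) : ℂ) *
        (-(Real.pi * Complex.I * ((-h : ℝ) : ℂ)) *
            mellin (fun t : ℝ => Complex.exp (-(t : ℂ) - ((Real.pi ^ 2 * (-h) ^ 2 : ℝ) : ℂ) / (t : ℂ))) (conj (0 : ℂ) - 1 / 2) -
          I * mellin (fun t : ℝ => Complex.exp (-(t : ℂ) - ((Real.pi ^ 2 * (-h) ^ 2 : ℝ) : ℂ) / (t : ℂ))) (conj (0 : ℂ) + 1 / 2))) = 0 := by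
  rw [map_zero, archLineWhittaker_centre_eq_zero_of_neg (neg_neg_iff_pos.mpr hh), map_zero]

end Summit.HodgeConjecture.HodgeConjecture.Cruxes.HLiu418.K2LiuRankOneArchWhittakerMirrorTypes

end
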